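import Literature.Topology.FourManifolds.MorseSeparateVariables
import HarnessLib

/-!
# Functions of separate variables: critical points project to critical points

Topic `Literature/Topology/FourManifolds` (small sequel of `MorseSeparateVariables.lean`; fact seat
`provefact-Literature.Geometry.Symplectic.Oba2016_s-add47373d4`: every critical point of Kas' function
on the central fibre comes from a critical point of the fibre Morse function).  Everything is
proved; no definitions, no named facts.

* `hasMFDerivAt_separateVariables` — the differential of `F = α ∘ g₁ + β ∘ g₂` at `x` is
  `dα ∘ dg₁ + dβ ∘ dg₂`;
* `isMCriticalPt_of_separateVariables_of_surjective` — **converse of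
  `Literature.Topology.FourManifolds.morseData_of_separateVariables`, first order**: if `x` is critical for `F`, `α` is
  critical at `g₁ x` and `dg₂` is onto at `x`, then `β` is critical at `g₂ x` (Milnor 1963, §2).

## References

* J. Milnor, *Morse theory*, Annals of Mathematics Studies 51 (1963), §2. [Milnor1963]
-/

open scoped Manifold ContDiff Topology
open Set Function Filter

noncomputable section

namespace Literature.Topology.FourManifolds

universe u

variable {E : Type*} [NormedAddCommGroup E] [NormedSpace ℝ E] {H : Type*} [TopologicalSpace H]
  {I : ModelWithCorners ℝ E H} {M : Type u} [TopologicalSpace M] [ChartedSpace H M]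
  {E₁ : Type*} [NormedAddCommGroup E₁] [NormedSpace ℝ E₁]
  {E₂ : Type*} [NormedAddCommGroup E₂] [NormedSpace ℝ E₂]

/-- **The differential of a function of separate variables**: if `F = α ∘ g₁ + β ∘ g₂` near `x`
then `dF_x = dα ∘ dg₁ + dβ ∘ dg₂`. [cite: Milnor1963, §2] -/
theorem hasMFDerivAt_separateVariables {g₁ : M → E₁} {g₂ : M → E₂} {x : M}
    (hg₁ : MDifferentiableAt I 𝓘(ℝ, E₁) g₁ x) (hg₂ : MDifferentiableAt I 𝓘(ℝ, E₂) g₂ x)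
    {F : M → ℝ} {α : E₁ → ℝ} {β : E₂ → ℝ}
    (hα : DifferentiableAt ℝ α (g₁ x)) (hβ : DifferentiableAt ℝ β (g₂ x))
    (hFev : F =ᶠ[𝓝 x] fun y => α (g₁ y) + β (g₂ y)) :
    HasMFDerivAt I 𝓘(ℝ, ℝ) F x
      ((fderiv ℝ α (g₁ x)).comp (mfderiv I 𝓘(ℝ, E₁) g₁ x) +
        (fderiv ℝ β (g₂ x)).comp (mfderiv I 𝓘(ℝ, E₂) g₂ x)) := by
  have h1 : HasMFDerivAt I 𝓘(ℝ, ℝ) (fun y => α (g₁ y)) x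
      ((fderiv ℝ α (g₁ x)).comp (mfderiv I 𝓘(ℝ, E₁) g₁ x)) :=
    hα.hasFDerivAt.hasMFDerivAt.comp x hg₁.hasMFDerivAt
  have h2 : HasMFDerivAt I 𝓘(ℝ, ℝ) (fun y => β (g₂ y)) x
      ((fderiv ℝ β (g₂ x)).comp (mfderiv I 𝓘(ℝ, E₂) g₂ x)) :=
    hβ.hasFDerivAt.hasMFDerivAt.comp x hg₂.hasMFDerivAt
  have h3 := h1.add h2
  exact h3.congr_of_eventuallyEq hFev

/-- **A critical point of a function of separate variables projects to a critical point of the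
second factor** when the first factor is critical and `dg₂` is onto: `0 = dF_x = dβ ∘ dg₂`
forces `dβ = 0` on the range of `dg₂`. [cite: Milnor1963, §2] -/
theorem isMCriticalPt_of_separateVariables_of_surjective {g₁ : M → E₁} {g₂ : M → E₂} {x : M}
    (hg₁ : MDifferentiableAt I 𝓘(ℝ, E₁) g₁ x) (hg₂ : MDifferentiableAt I 𝓘(ℝ, E₂) g₂ x)
    (hsurj : Surjective (mfderiv I 𝓘(ℝ, E₂) g₂ x))
    {F : M → ℝ} {α : E₁ → ℝ} {β : E₂ → ℝ}
    (hα : DifferentiableAt ℝ α (g₁ x)) (hβ : DifferentiableAt ℝ β (g₂ x))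
    (hFev : F =ᶠ[𝓝 x] fun y => α (g₁ y) + β (g₂ y))
    (hα1 : IsMCriticalPt 𝓘(ℝ, E₁) α (g₁ x)) (hF : IsMCriticalPt I F x) :
    IsMCriticalPt 𝓘(ℝ, E₂) β (g₂ x) := by
  rw [isMCriticalPt_model_iff hα] at hα1
  rw [isMCriticalPt_model_iff hβ]
  have hD := hasMFDerivAt_separateVariables hg₁ hg₂ hα hβ hFev
  rw [hα1, ContinuousLinearMap.zero_comp, zero_add] at hD
  unfold IsMCriticalPt at hF
  rw [hD.mfderiv] at hF
  ext w
  obtain ⟨v, hv⟩ := hsurj w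
  have h : fderiv ℝ β (g₂ x) (mfderiv I 𝓘(ℝ, E₂) g₂ x v) = 0 := DFunLike.congr_fun hF v
  rw [hv] at h
  exact h

end Literature.Topology.FourManifolds

end
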